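import Summits.AnomalousDissipation.AnomalousDissipation.Theorems.QuasiStaticSolenoidalCellTensorQ.Negative.Drift
import HarnessLib

/-!
# Negative side of K2Q `QuasiStaticSolenoidalCellTensorQ` (stmt-AnomalousDissipation-19072): the Taylor drain density of the
# cell truncation in closed form and its frozen-polarisation majorant (helper, `--supports stmt-AnomalousDissipation-19072`)

Summits-side helper file (everything proved; no definitions, no named facts).
* `drainDensity_eq` — by conjugate symmetry of the Galerkin coefficients the drain density `ψ` of `exchange_le_cell`
  (a sum over the principal pair `±ℓ`) is `½ Σ_j ‖C_j(t,ℓ)‖²(‖a_j‖² + ‖a'_j‖²)(X⁻_j + X⁺_j)`,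
  `X^∓_j = ‖Π_{ℓ∓K_j} α_N(t)(ℓ)‖²/(κ4π²|ℓ∓K_j|²)`;
* `norm_sq_slotCoeff` — `‖C_j(t,k)‖² = (trap_j(t)/n)²·(2π Σᵢ ê_j,ᵢ kᵢ)²`;
* `polarisation_frozen` — on a window where the rest energy is `≤ R_max`:
  `‖Π_m α_N(t)(ℓ)‖² ≤ (1+ε)‖Π_m α_N(t₀)(ℓ)‖² + (1+1/ε)δ²`, `δ = e^{κ4π²|ℓ|²(t₁−t₀)}·c_F·√R_max·(t₁−t₀)`
  (`principal_drift` + `norm_sq_leraySym_le_of_drift`; the heat factor only helps).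
This is NOT a proof of anomalous dissipation, and by itself not of `¬ K2Q`.
-/

set_option linter.dupNamespace false

noncomputable section

namespace Summit.AnomalousDissipation.AnomalousDissipation.Theorems.QuasiStaticSolenoidalCellTensorQ.Negative

open Set MeasureTheory Filter Topology Function
open scoped InnerProductSpace ComplexConjugate BigOperators
open Literature.Analysis Literature.Analysis.FunctionSpaces Literature.Analysis.FunctionSpaces.Torus
open Literature.Analysis.FluidPDE Literature.Analysis.FluidPDE.LatticeShear
open Summit.AnomalousDissipation.AnomalousDissipation.Theorems.SolenoidalFractalHomogenisation.PermissibleCarrier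
open Summit.AnomalousDissipation.AnomalousDissipation.Theorems.SolenoidalFractalHomogenisation.RealisedQuasiStaticCellLaw

variable {k₀ : ℕ}

/-! ## §1 Conjugate symmetry folds the principal pair -/

/-- For a conjugate-symmetric family: `‖Π_{-k∓K} α(-k)‖ = ‖Π_{k±K} α(k)‖`. -/
theorem norm_leraySym_neg_pair {α : (Fin 3 → ℤ) → EuclideanSpace ℂ (Fin 3)} (hα : Torus.IsConjSymm α) (k K : Fin 3 → ℤ) :
    ‖Torus.leraySym (-k - K) (α (-k))‖ = ‖Torus.leraySym (k + K) (α k)‖ ∧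
      ‖Torus.leraySym (-k + K) (α (-k))‖ = ‖Torus.leraySym (k - K) (α k)‖ := by
  constructor
  · rw [hα k, show -k - K = -(k + K) by abel, Torus.leraySym_neg_freq, ← Torus.conjVec_leraySym,
      EuclideanSpace.norm_conjVec]
  · rw [hα k, show -k + K = -(k - K) by abel, Torus.leraySym_neg_freq, ← Torus.conjVec_leraySym,
      EuclideanSpace.norm_conjVec]

/-- **The squared norm of the slot coefficient**: `‖(c : ℂ)·(2πi Σᵢ êᵢ kᵢ)‖² = c²(2π Σᵢ êᵢ kᵢ)²` for real `c`, `ê`. -/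
theorem norm_sq_slotCoeff (c : ℝ) (e : EuclideanSpace ℝ (Fin 3)) (k : Fin 3 → ℤ) :
    ‖((c : ℝ) : ℂ) * (2 * Real.pi * Complex.I * ∑ i, (EuclideanSpace.complexify e) i * (k i : ℂ))‖ ^ 2 =
      c ^ 2 * (2 * Real.pi * ∑ i, e i * (k i : ℝ)) ^ 2 := by
  have hsumE : (∑ i, (EuclideanSpace.complexify e) i * (k i : ℂ)) = ((∑ i, e i * (k i : ℝ) : ℝ) : ℂ) := by
    push_cast
    refine Finset.sum_congr rfl fun i _ => ?_
    rw [EuclideanSpace.complexify_apply]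
  have e1 : ((c : ℝ) : ℂ) * (2 * Real.pi * Complex.I * ∑ i, (EuclideanSpace.complexify e) i * (k i : ℂ)) =
      ((c * (2 * Real.pi * ∑ i, e i * (k i : ℝ)) : ℝ) : ℂ) * Complex.I := by
    rw [hsumE]; push_cast; ring
  rw [e1, norm_mul, Complex.norm_I, mul_one, Complex.norm_real, Real.norm_eq_abs, sq_abs]
  ring

/-- The slot coefficient has the same norm at `-k` as at `k`. -/
theorem norm_sq_slotCoeff_neg (c : ℝ) (e : EuclideanSpace ℝ (Fin 3)) (k : Fin 3 → ℤ) :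
    ‖((c : ℝ) : ℂ) * (2 * Real.pi * Complex.I * ∑ i, (EuclideanSpace.complexify e) i * ((-k) i : ℂ))‖ ^ 2 =
      ‖((c : ℝ) : ℂ) * (2 * Real.pi * Complex.I * ∑ i, (EuclideanSpace.complexify e) i * (k i : ℂ))‖ ^ 2 := by
  rw [norm_sq_slotCoeff, norm_sq_slotCoeff]
  have : ∑ i, e i * (((-k) i : ℤ) : ℝ) = -∑ i, e i * ((k i : ℤ) : ℝ) := by
    rw [← Finset.sum_neg_distrib]
    refine Finset.sum_congr rfl fun i _ => ?_
    simp only [Pi.neg_apply, Int.cast_neg, mul_neg]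
  rw [this]
  ring

/-- **The drain density folded on one principal mode.** For a conjugate-symmetric `α`, `ℓ ≠ -ℓ`, real `c`, `ê`,
scalars `A, A'` and `κ`:
`Σ_{k=±ℓ} ‖C(k)‖²(‖A‖²‖Π_{k-K}α(k)‖²/w(k-K) + ‖A'‖²‖Π_{k+K}α(k)‖²/w(k+K))
   = ‖C(ℓ)‖²(‖A‖² + ‖A'‖²)(‖Π_{ℓ-K}α(ℓ)‖²/w(ℓ-K) + ‖Π_{ℓ+K}α(ℓ)‖²/w(ℓ+K))`, `w(m) = κ4π²|m|²`. -/
theorem drainDensity_pair_eq {α : (Fin 3 → ℤ) → EuclideanSpace ℂ (Fin 3)} (hα : Torus.IsConjSymm α)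
    {ℓ : Fin 3 → ℤ} (hℓℓ : ℓ ≠ -ℓ) (K : Fin 3 → ℤ) (c : ℝ) (e : EuclideanSpace ℝ (Fin 3)) (A A' : ℂ) (κ : ℝ) :
    ∑ k ∈ ({ℓ, -ℓ} : Finset (Fin 3 → ℤ)),
        ‖((c : ℝ) : ℂ) * (2 * Real.pi * Complex.I * ∑ i, (EuclideanSpace.complexify e) i * (k i : ℂ))‖ ^ 2 *
          (‖A‖ ^ 2 * ‖Torus.leraySym (k - K) (α k)‖ ^ 2 / (κ * (4 * Real.pi ^ 2 * freqNormSq (k - K))) +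
            ‖A'‖ ^ 2 * ‖Torus.leraySym (k + K) (α k)‖ ^ 2 / (κ * (4 * Real.pi ^ 2 * freqNormSq (k + K)))) =
      ‖((c : ℝ) : ℂ) * (2 * Real.pi * Complex.I * ∑ i, (EuclideanSpace.complexify e) i * (ℓ i : ℂ))‖ ^ 2 *
        (‖A‖ ^ 2 + ‖A'‖ ^ 2) *
        (‖Torus.leraySym (ℓ - K) (α ℓ)‖ ^ 2 / (κ * (4 * Real.pi ^ 2 * freqNormSq (ℓ - K))) +
          ‖Torus.leraySym (ℓ + K) (α ℓ)‖ ^ 2 / (κ * (4 * Real.pi ^ 2 * freqNormSq (ℓ + K)))) := by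
  rw [Finset.sum_pair hℓℓ, norm_sq_slotCoeff_neg, (norm_leraySym_neg_pair hα ℓ K).1, (norm_leraySym_neg_pair hα ℓ K).2,
    show -ℓ - K = -(ℓ + K) by abel, show -ℓ + K = -(ℓ - K) by abel, freqNormSq_neg, freqNormSq_neg]
  ring

/-! ## §2 Frozen polarisation along a window -/

/-- Rescaling by a real factor `≥ 1` does not decrease the Leray norm: `‖Π_m v‖ ≤ ‖Π_m (r • v)‖` for `1 ≤ r`. -/
theorem norm_leraySym_le_of_one_le_smul (m : Fin 3 → ℤ) (v : EuclideanSpace ℂ (Fin 3)) {r : ℝ} (hr : 1 ≤ r) :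
    ‖Torus.leraySym m v‖ ≤ ‖Torus.leraySym m (((r : ℝ) : ℂ) • v)‖ := by
  rw [Torus.leraySym_smul, norm_smul, Complex.norm_real, Real.norm_eq_abs, abs_of_pos (by linarith)]
  exact le_mul_of_one_le_left (norm_nonneg _) hr

set_option maxHeartbeats 800000 in
/-- **Frozen polarisation.** In the setting of `principal_drift` (window `[t₀, t₁] ⊆ [0, T]`, rest energy `≤ R_max`),
for every frequency `m`, every `ε > 0` and every `t ∈ [t₀, t₁]`:
`‖Π_m α_N(t)(ℓ)‖² ≤ (1+ε)‖Π_m α_N(t₀)(ℓ)‖² + (1 + 1/ε)·δ²`, `δ = e^{κ4π²|ℓ|²(t₁−t₀)}·c_F·√R_max·(t₁ − t₀)`. -/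
theorem polarisation_frozen (W : LatticeWord k₀) {n : ℕ} (hn : 0 < n) {κ : ℝ} (hκ : 0 < κ)
    (ℓ : Fin 3 → ℤ) (hℓ : ℓ ≠ 0) (hℓn : 2 * ‖latticeVec ℓ‖ < n) {w₀ : UnitAddTorus (Fin 3) → EuclideanSpace ℝ (Fin 3)}
    (hw₀ : FunctionSpaces.Torus.MemSobolev 1 (FunctionSpaces.EuclideanSpace.complexify ∘ w₀))
    (hdiv : FunctionSpaces.Torus.IsWeaklyDivFree w₀) (hmean : FunctionSpaces.Torus.HasZeroMean w₀)
    (hsupp : ∀ k : Fin 3 → ℤ, ¬ ((∃ z : Fin 3 → ℤ, k = ℓ + (n:ℤ) • z) ∨ (∃ z : Fin 3 → ℤ, k = -ℓ + (n:ℤ) • z)) →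
      UnitAddTorus.mFourierCoeff (FunctionSpaces.EuclideanSpace.complexify ∘ w₀) k = 0)
    {N : ℕ} (hBN : (Finset.univ.biUnion fun j : Fin k₀ =>
        ({(fun i => (W.phase j).m i * n), -(fun i => (W.phase j).m i * n)} : Finset (Fin 3 → ℤ))) ⊆ freqBall N)
    (hℓN : ℓ ∈ freqBall N)
    (hball : ∀ j : Fin k₀, ∀ k ∈ ({ℓ, -ℓ} : Finset (Fin 3 → ℤ)),
      k - (fun i => (W.phase j).m i * (n : ℤ)) ∈ freqBall N ∧ k + (fun i => (W.phase j).m i * (n : ℤ)) ∈ freqBall N)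
    {T t₀ t₁ : ℝ} (ht₀ : 0 ≤ t₀) (ht₀₁ : t₀ ≤ t₁) (ht₁ : t₁ ≤ T) {Rmax : ℝ}
    (hR : ∀ t ∈ Icc t₀ t₁, ∑ k ∈ freqBall N \ {ℓ, -ℓ},
      ‖(pvSetup_cell W hn hκ.le ℓ hw₀ hdiv hmean hsupp).galerkinCoeffAt N t k‖ ^ 2 ≤ Rmax)
    (m : Fin 3 → ℤ) {ε : ℝ} (hε : 0 < ε) :
    ∀ t ∈ Icc t₀ t₁,
      ‖Torus.leraySym m ((pvSetup_cell W hn hκ.le ℓ hw₀ hdiv hmean hsupp).galerkinCoeffAt N t ℓ)‖ ^ 2 ≤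
        (1 + ε) * ‖Torus.leraySym m ((pvSetup_cell W hn hκ.le ℓ hw₀ hdiv hmean hsupp).galerkinCoeffAt N t₀ ℓ)‖ ^ 2 +
          (1 + 1 / ε) * (Real.exp (κ * (4 * Real.pi ^ 2 * freqNormSq ℓ) * (t₁ - t₀)) *
            ((∑ j : Fin k₀, (1 / (n : ℝ)) * (2 * Real.pi * |∑ i, (W.phase j).e i * (ℓ i : ℝ)|) *
                (‖Complex.exp ((W.phase j).φ * Complex.I) *
                    (1 / (2 * ((2 * Real.pi * ‖latticeVec (W.phase j).m‖ : ℝ) : ℂ) * Complex.I))‖ +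
                  ‖starRingEnd ℂ (Complex.exp ((W.phase j).φ * Complex.I)) *
                    (-(1 / (2 * ((2 * Real.pi * ‖latticeVec (W.phase j).m‖ : ℝ) : ℂ) * Complex.I)))‖)) *
              Real.sqrt Rmax) * (t₁ - t₀)) ^ 2 := by
  intro t ht
  set hPV := pvSetup_cell W hn hκ.le ℓ hw₀ hdiv hmean hsupp with hPVdef
  have hdrift := principal_drift W hn hκ ℓ hℓ hℓn hw₀ hdiv hmean hsupp hBN hℓN hball ht₀ ht₀₁ ht₁ hR t ht
  set L : ℝ := κ * (4 * Real.pi ^ 2 * freqNormSq ℓ) with hL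
  have hL0 : 0 ≤ L := by rw [hL]; exact mul_nonneg hκ.le (mul_nonneg (by positivity) (freqNormSq_nonneg _))
  set u : EuclideanSpace ℂ (Fin 3) := ((Real.exp (L * (t - t₀)) : ℝ) : ℂ) • hPV.galerkinCoeffAt N t ℓ with hu
  have h1 : ‖Torus.leraySym m (hPV.galerkinCoeffAt N t ℓ)‖ ≤ ‖Torus.leraySym m u‖ :=
    norm_leraySym_le_of_one_le_smul m _ (Real.one_le_exp (mul_nonneg hL0 (by linarith [ht.1])))
  have h2 := norm_sq_leraySym_le_of_drift m u (hPV.galerkinCoeffAt N t₀ ℓ) hε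
  have h3 : ‖u - hPV.galerkinCoeffAt N t₀ ℓ‖ ≤ Real.exp (L * (t₁ - t₀)) *
      ((∑ j : Fin k₀, (1 / (n : ℝ)) * (2 * Real.pi * |∑ i, (W.phase j).e i * (ℓ i : ℝ)|) *
          (‖Complex.exp ((W.phase j).φ * Complex.I) *
              (1 / (2 * ((2 * Real.pi * ‖latticeVec (W.phase j).m‖ : ℝ) : ℂ) * Complex.I))‖ +
            ‖starRingEnd ℂ (Complex.exp ((W.phase j).φ * Complex.I)) *
              (-(1 / (2 * ((2 * Real.pi * ‖latticeVec (W.phase j).m‖ : ℝ) : ℂ) * Complex.I)))‖)) *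
        Real.sqrt Rmax) * (t₁ - t₀) := by
    refine hdrift.trans ?_
    refine mul_le_mul_of_nonneg_left (by linarith [ht.2]) ?_
    refine mul_nonneg (Real.exp_pos _).le (mul_nonneg (Finset.sum_nonneg fun j _ => ?_) (Real.sqrt_nonneg _))
    positivity
  have h4 : ‖u - hPV.galerkinCoeffAt N t₀ ℓ‖ ^ 2 ≤ (Real.exp (L * (t₁ - t₀)) *
      ((∑ j : Fin k₀, (1 / (n : ℝ)) * (2 * Real.pi * |∑ i, (W.phase j).e i * (ℓ i : ℝ)|) *
          (‖Complex.exp ((W.phase j).φ * Complex.I) *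
              (1 / (2 * ((2 * Real.pi * ‖latticeVec (W.phase j).m‖ : ℝ) : ℂ) * Complex.I))‖ +
            ‖starRingEnd ℂ (Complex.exp ((W.phase j).φ * Complex.I)) *
              (-(1 / (2 * ((2 * Real.pi * ‖latticeVec (W.phase j).m‖ : ℝ) : ℂ) * Complex.I)))‖)) *
        Real.sqrt Rmax) * (t₁ - t₀)) ^ 2 := pow_le_pow_left₀ (norm_nonneg _) h3 2
  have h5 : ‖Torus.leraySym m (hPV.galerkinCoeffAt N t ℓ)‖ ^ 2 ≤ ‖Torus.leraySym m u‖ ^ 2 :=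
    pow_le_pow_left₀ (norm_nonneg _) h1 2
  have hε' : 0 ≤ 1 + 1 / ε := by positivity
  nlinarith [mul_le_mul_of_nonneg_left h4 hε']

end Summit.AnomalousDissipation.AnomalousDissipation.Theorems.QuasiStaticSolenoidalCellTensorQ.Negative

end
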